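import Literature.NumberTheory.ComplexMultiplication.ReflexNormArtinMap
import Literature.NumberTheory.NumberFields.IdelicArtinMapCyclotomicCharacter
import HarnessLib

/-!
# Milne, *Complex Multiplication*, Ch. II §9, LEMMA 9.7 with its cyclotomic character:
# `N_Φ(s) · ι_E N_Φ(s) ∈ χ_cyc(art_{E*}(s)) · ℚ^×`

Layer `Literature/NumberTheory/ComplexMultiplication`; namespace `Literature.NumberTheory.ComplexMultiplication`.
Lane `lit-hodgefound` (Track 2, Layer A3 skeleton seat `skel-3`, row A3-G40, rider to row A3-G39 FILE 3
`…ComplexMultiplication/ReflexNormArtinMap`).  THEOREMS ONLY, all proved: no definition, no named fact, no `sorry`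
(D-0026, net debt 0).

## The print

J. S. Milne, *Complex Multiplication* (course notes, version of July 14, 2020; open text `paper:url-8ccc30e4daab`,
p0077 L10–L14) [MilneCM2006], Ch. II §9:

> «LEMMA 9.7 Let `E` be a CM-field and let `Φ` be a CM-type on `E`. For any `s ∈ 𝔸^×_{f,E*}`,
> `N_Φ(s) · ι_E N_Φ(s) ∈ χ_cyc(art_{E*}(s)) · ℚ_{>0}`.
> PROOF. According to (10), `N_Φ(s) · ι_E N_Φ(s) = Nm_{E*/ℚ}(s)`, and so we can apply (9.5).»

and, in the proof of PROPOSITION 9.9 (p0077 L29–L33): «Let `σ ∈ Gal(ℚ^al/ℚ)` be such that `σ|E^ab = art_{E*}(s) =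
art_{E*}(s')`. Then (see 9.5), `N_Φ(s) · ι_E N_Φ(s) = χ_cyc(σ) · E^× = N_Φ(s') · ι_E N_Φ(s')`.»

Row A3-G39 FILE 3 proved the case `art_{E*}(s) = 1` of this clause (`finitePart_reflexNormIdele_mul_conj_mem_range`:
`N_{k,Φ}(s)_𝐡 · ι_E N_{k,Φ}(s)_𝐡 ∈ E^×` for `[s, k] = 1`), which is all that PROP. 9.9 needs.  With the cyclotomic
character now ONE idelic object (row A3-G40: `cyclotomicFiniteIdele = χ_cyc : Γ_ℚ →* 𝔸^×_{ℚ,f}`, LEMMA 9.4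
`ideleArtinMap_cyclotomicIdele`, and the `χ_cyc`-clause of LEMMA 9.5 `finitePart_ideleRelNorm_mul_cyclotomicIdele_mem_range`)
the lemma is recorded here AS PRINTED, for a general `s` and its `σ`.

## Setting and conventions (as in `…/ReflexNormArtinMap` and `…/IdelicArtinMapCyclotomicCharacter`)

`E = K : Type` a CM number field with `ι_E` transported to the finite idèles (`finiteIdeleComplexConj K`),
`Φ : CMType K`, `E* = traceField Φ ⊂ ℂ`, `k : IntermediateField ℚ ℂ` a number field with `hk : traceField Φ ≤ k`
(the printed case is `k = E*`; `N_{k,Φ} = reflexNormIdele K Φ k`, `= N_Φ ∘ Nm_{k/E*}`), `con = AdeleRing.baseChange ℚ K`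
(`𝕀_ℚ → 𝕀_K`), `x_𝐡 = IdeleAction.finitePart`.  The tree's Artin map `[·, k] = ideleArtinMap k` is `rec_k = art_k⁻¹`
(MILNE: `art_k(s) = rec_k(s)⁻¹`); accordingly Milne's `σ` with «`σ|E^ab = art_{E*}(s)`» is `τ⁻¹` for any `τ ∈ Γ_k`
lifting `[s, k]` (`absGaloisAbProj k τ = ideleArtinMap k s`), and «`∈ χ_cyc(σ) · ℚ^×`» becomes
«`· χ_cyc(res_{k/ℚ} τ) ∈ ℚ^×`», equivalently «`∈ ℚ^× · χ_cyc(res_{k/ℚ} τ⁻¹)`».  As in LEMMA 9.5 (row A3-G40 FILE 2,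
DEVIATION stated there) the sign «`ℚ_{>0}`» is archimedean — it constrains `(Nm s)_∞` — and is not asserted for a
full idèle `s`; what is proved is the finite-part statement with `ℚ^×`.

## What is proved

* **`finitePart_reflexNormIdele_mul_conj_mul_con_cyclotomicIdele_mem_range`** (LEMMA 9.7, the `χ_cyc`-clause):
  `N_{k,Φ}(s)_𝐡 · ι_E N_{k,Φ}(s)_𝐡 · con(1, χ_cyc(res τ))_𝐡 ∈ E^×` (a principal finite idèle of `E`, indeed `(q)_E`
  with `q ∈ ℚ^×`) whenever `τ ∈ Γ_k` lifts `[s, k]` — by (10) on finite parts (`finitePart_reflexNormIdele_mul_conj`,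
  A3-G39 FILE 3) and the `χ_cyc`-clause of 9.5 (`finitePart_ideleRelNorm_mul_cyclotomicIdele_mem_range`, A3-G40
  FILE 2) pushed through the conorm (`finitePart_map_baseChange_mem_range`).
* **`exists_finitePart_reflexNormIdele_mul_conj_eq_mul_cyclotomic`**: the coset form with an explicit rational
  witness, `N_{k,Φ}(s)_𝐡 · ι_E N_{k,Φ}(s)_𝐡 = (q)_E · con_f(χ_cyc(res τ⁻¹))` in `𝔸_{E,f}`, `q ∈ ℚ^×` — Milne's
  «`N_Φ(s) · ι_E N_Φ(s) ∈ χ_cyc(σ) · ℚ^×`», `σ = τ⁻¹`.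
* `finitePart_reflexNormIdele_mul_conj_eq_of_absGaloisAbProj_eq` (the form used in the proof of PROP. 9.9): if one
  `τ` lifts both `[s, k]` and `[s', k]` then `N(s)_𝐡 · ιN(s)_𝐡` and `N(s')_𝐡 · ιN(s')_𝐡` differ by a principal
  finite idèle `(q)_E`, `q ∈ ℚ^×` («`= χ_cyc(σ) · E^× =`»).

## References

* J. S. Milne, *Complex Multiplication* (2006; version July 14, 2020), Ch. II §9, Lemma 9.7 and the proof of Prop. 9.9
  (p. 77); Ch. I §1 (10). [MilneCM2006]
* G. Shimura, *Abelian Varieties with Complex Multiplication and Modular Functions* (1998), §18.5 (18.5c), §19.7.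
  [Shimura1998]
* J. W. S. Cassels, A. Fröhlich (eds.), *Algebraic Number Theory* (1967), Ch. II §19 (norm and conorm on idèles),
  Ch. VII §5.7. [CasselsFrohlichANT1967]

## Provenance

Lane `lit-hodgefound`, seat `literature-prover-lit-hodgefound-skel-3-g26-0` (row A3-G40, rider = FILE 3).
-/

set_option autoImplicit false

noncomputable section

open scoped TensorProduct NumberField

namespace Literature.NumberTheory.ComplexMultiplication

open Literature.AlgebraicGeometry.GaoUllmo2025
open Literature.AlgebraicGeometry.Motives (CMType)
open Literature.NumberTheory.AdelicBaseChange
open Literature.NumberTheory.GaloisRepresentations (ideleGroup absGaloisAbProj absGaloisRestrict)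
open Literature.NumberTheory.NumberFields
open NumberField IsDedekindDomain Field

section NinePointSeven

variable (K : Type) [Field K] [NumberField K] [IsCMField K] (Φ : CMType K)
  (k : IntermediateField ℚ ℂ) [NumberField k]

/-- **MILNE CM LEMMA 9.7, THE `χ_cyc`-CLAUSE: `N_{k,Φ}(s)_𝐡 · ι_E N_{k,Φ}(s)_𝐡 · con(χ_cyc(res_{k/ℚ} τ))_𝐡 ∈ E^×`**
whenever `τ ∈ Γ_k` lifts `[s, k]` — i.e. «`N_Φ(s) · ι_E N_Φ(s) ∈ χ_cyc(σ) · ℚ^× ⊆ χ_cyc(σ) · E^×`» on finite parts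
with Milne's `σ = τ⁻¹` (`art = rec⁻¹`).  PROOF (Milne's): «According to (10), `N_Φ(s) · ι_E N_Φ(s) = Nm_{E*/ℚ}(s)`,
and so we can apply (9.5)»: `finitePart_reflexNormIdele_mul_conj` ((10) on finite parts) and the `χ_cyc`-clause of
9.5 for `k/ℚ` (`finitePart_ideleRelNorm_mul_cyclotomicIdele_mem_range`), transported by the conorm
(`finitePart_map_baseChange_mem_range`). [cite: MilneCM2006, Ch. II §9, Lemma 9.7 (p. 77)]
[cite: Shimura1998, §18.5 (18.5c)] -/
theorem finitePart_reflexNormIdele_mul_conj_mul_con_cyclotomicIdele_mem_range (hk : traceField Φ ≤ k)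
    {s : ideleGroup k} {τ : absoluteGaloisGroup k} (hτ : absGaloisAbProj k τ = ideleArtinMap k s) :
    IdeleAction.finitePart K (reflexNormIdele K Φ k s) *
          finiteIdeleComplexConj K (IdeleAction.finitePart K (reflexNormIdele K Φ k s)) *
        IdeleAction.finitePart K
          (Units.map (NumberField.AdeleRing.baseChange ℚ K : AdeleRing (𝓞 ℚ) ℚ →* AdeleRing (𝓞 K) K)
            (cyclotomicIdele (absGaloisRestrict ℚ k τ))) ∈
      (FiniteAdeleRing.unitEmbedding (𝓞 K) K).range := by
  rw [finitePart_reflexNormIdele_mul_conj K Φ k hk s, ← map_mul, ← map_mul]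
  exact finitePart_map_baseChange_mem_range K (finitePart_ideleRelNorm_mul_cyclotomicIdele_mem_range s hτ)

/-- **LEMMA 9.7 as a coset statement with an explicit rational witness**: if `τ ∈ Γ_k` lifts `[s, k]` then
`N_{k,Φ}(s)_𝐡 · ι_E N_{k,Φ}(s)_𝐡 = (q)_E · con_f(χ_cyc(res_{k/ℚ} τ⁻¹))` in `𝔸_{E,f}` for some `q ∈ ℚ^×` — Milne's
«`N_Φ(s) · ι_E N_Φ(s) ∈ χ_cyc(σ) · ℚ^×`» with `σ = τ⁻¹`; here `con_f = FiniteAdeleRing.mapSemialgHom (𝓞 ℚ) ℚ K (𝓞 K)`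
is the finite component of `AdeleRing.baseChange ℚ K` and `(q) = Nm_{k/ℚ}(s)_𝐡 · χ_cyc(res τ)`.
[cite: MilneCM2006, Ch. II §9, Lemma 9.7 (p. 77)] [cite: Shimura1998, §18.5 (18.5c)] -/
theorem exists_finitePart_reflexNormIdele_mul_conj_eq_mul_cyclotomic (hk : traceField Φ ≤ k)
    {s : ideleGroup k} {τ : absoluteGaloisGroup k} (hτ : absGaloisAbProj k τ = ideleArtinMap k s) :
    ∃ q : ℚˣ,
      ((IdeleAction.finitePart K (reflexNormIdele K Φ k s) *
            finiteIdeleComplexConj K (IdeleAction.finitePart K (reflexNormIdele K Φ k s)) :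
            (FiniteAdeleRing (𝓞 K) K)ˣ) : FiniteAdeleRing (𝓞 K) K) =
        algebraMap K (FiniteAdeleRing (𝓞 K) K) (algebraMap ℚ K (q : ℚ)) *
          FiniteAdeleRing.mapSemialgHom (𝓞 ℚ) ℚ K (𝓞 K)
            ((cyclotomicFiniteIdele (absGaloisRestrict ℚ k τ⁻¹) : (FiniteAdeleRing (𝓞 ℚ) ℚ)ˣ) :
              FiniteAdeleRing (𝓞 ℚ) ℚ) := by
  obtain ⟨q, hq⟩ := exists_finitePart_ideleRelNorm_eq_unitEmbedding_mul_cyclotomicFiniteIdele s hτ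
  refine ⟨q, ?_⟩
  have hq' : ((ideleRelNorm ℚ k s : ideleGroup ℚ) : AdeleRing (𝓞 ℚ) ℚ).2 =
      algebraMap ℚ (FiniteAdeleRing (𝓞 ℚ) ℚ) (q : ℚ) *
        ((cyclotomicFiniteIdele (absGaloisRestrict ℚ k τ⁻¹) : (FiniteAdeleRing (𝓞 ℚ) ℚ)ˣ) :
          FiniteAdeleRing (𝓞 ℚ) ℚ) := by
    rw [← IdeleAction.coe_finitePart, hq, Units.val_mul, FiniteAdeleRing.unitEmbedding_apply]
  rw [finitePart_reflexNormIdele_mul_conj K Φ k hk s, IdeleAction.coe_finitePart, Units.coe_map, MonoidHom.coe_coe,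
    NumberField.AdeleRing.baseChange_snd_apply, hq', map_mul]
  congr 1
  exact ContinuousSemialgHom.commutes _ _ _ (FiniteAdeleRing.mapSemialgHom (𝓞 ℚ) ℚ K (𝓞 K)) (q : ℚ)

/-- **«`N_Φ(s) · ι_E N_Φ(s) = χ_cyc(σ) · E^× = N_Φ(s') · ι_E N_Φ(s')`»** (proof of PROP. 9.9): if ONE `τ ∈ Γ_k` lifts both
`[s, k]` and `[s', k]` (i.e. `[s, k] = [s', k]`), then `N_{k,Φ}(s)_𝐡 · ι_E N_{k,Φ}(s)_𝐡` and
`N_{k,Φ}(s')_𝐡 · ι_E N_{k,Φ}(s')_𝐡` lie in the same coset of the principal finite idèles `E^×` — both are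
`≡ con(χ_cyc(res τ))⁻¹`. [cite: MilneCM2006, Ch. II §9, proof of Prop. 9.9 (p. 77)] -/
theorem finitePart_reflexNormIdele_mul_conj_quotient_eq_of_absGaloisAbProj_eq (hk : traceField Φ ≤ k)
    {s s' : ideleGroup k} {τ : absoluteGaloisGroup k} (hτ : absGaloisAbProj k τ = ideleArtinMap k s)
    (hτ' : absGaloisAbProj k τ = ideleArtinMap k s') :
    (QuotientGroup.mk (s := (FiniteAdeleRing.unitEmbedding (𝓞 K) K).range)
        (IdeleAction.finitePart K (reflexNormIdele K Φ k s) *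
          finiteIdeleComplexConj K (IdeleAction.finitePart K (reflexNormIdele K Φ k s))) :
        (FiniteAdeleRing (𝓞 K) K)ˣ ⧸ (FiniteAdeleRing.unitEmbedding (𝓞 K) K).range) =
      QuotientGroup.mk
        (IdeleAction.finitePart K (reflexNormIdele K Φ k s') *
          finiteIdeleComplexConj K (IdeleAction.finitePart K (reflexNormIdele K Φ k s'))) := by
  have h := finitePart_reflexNormIdele_mul_conj_mul_con_cyclotomicIdele_mem_range K Φ k hk hτ
  have h' := finitePart_reflexNormIdele_mul_conj_mul_con_cyclotomicIdele_mem_range K Φ k hk hτ'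
  -- `a / a' = (a c) / (a' c)` with `c = con(1, χ_cyc(res τ))_𝐡`
  rw [QuotientGroup.eq_iff_div_mem, ← mul_div_mul_right_eq_div _ _
    (IdeleAction.finitePart K
      (Units.map (NumberField.AdeleRing.baseChange ℚ K : AdeleRing (𝓞 ℚ) ℚ →* AdeleRing (𝓞 K) K)
        (cyclotomicIdele (absGaloisRestrict ℚ k τ))))]
  exact div_mem h h'

end NinePointSeven

end Literature.NumberTheory.ComplexMultiplication

end
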